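import Literature.MathematicalPhysics.QuantumFieldTheory.Balaban1983to89.B8Ineq159FlatOfScalar
import Literature.MathematicalPhysics.QuantumFieldTheory.Balaban1983to89.B9SupplySockB9P3ZdBeta

/-!
# `Balaban1983to89.B8Ineq159FlatOfScalarBdryBeta` — [Balaban1985RegularSpaces] (1.59) p. 86 AT THE FLAT BACKGROUND `U₀ = 1`, IN EDITION β
# (averaging datum `|B₁|β` over `Λb ∪ {level-0 crossing bonds of Ω₀}`, exterior-collar term): Theorem 4's two-member (1.59) clause for `𝔸`-VALUED
# exponents FOLLOWS from the same clause for SCALAR bond functions in the flat Landau gauge — the `⊗ id` reduction of [4] p. 394, re-run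

statement-level skeleton of published theorems with citation tags; proofs where landed; nothing here is a claim about the
Yang–Mills mass gap

`[Balaban1985RegularSpaces]` ("B8", CMP **99** (1985) 75–102) (1.59) p. 86, (1.58) p. 86, (1.31) p. 82, Thm 4 p. 88, (1.36)–(1.38) p. 82, p. 77; [4] =
`[Balaban1985BackgroundPropagators]` Thm 3.3 p. 399, (3.47) p. 398, (3.16) p. 393, p. 394 («⊗ identity»).  PDF held:
`paper:balaban1985-cmp99-regular-spaces-gauge-fixing`.

CITATION HEADER (lean-in-tree rule).  Cell `pub-ymgap` (HUMAN RULING D-0062, Track A), DAG node N05 = [B8], seat `pub-ymgap-dag-n05-e` g8 (R141 (C) row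
s3b — the FLAT LINE re-keyed to the socket of record).  WHY: the flat line of this seat (g5–g7: `B8Ineq159FlatOfScalarBdry` p526768 … `B8Prop6CubeMemberScalarBdry`
p534762) reads the (1.59) clauses in the currency R-d, whose averaging datum `|B₁|` misses the level-0 CROSSING bonds of the finite region `□₀` — the boundary
pure-gauge mode `d𝟙_{□₀}` refutes such clauses (dag-n06-b CANDIDATE-3, p539131; director-ym №189).  The socket of record is EDITION β (dag-lead RULING №189 (2);
dag-n06-b `B9SupplySockB9P3ZdBeta`, p541339): the crossing bonds join `|B₁|` (print's «B on Λ₀», (1.31); [4] (3.16)).  THIS FILE re-runs the g7 transfer in β: ★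
`flat159_clause_of_scalar_bdryβ` — the SCALAR flat two-line β clause ⟹ the `𝔸`-valued two-line β clause at `U₀ = 1` (Hahn–Banach + the `⊗ id` maps of
`B8Ineq159FlatMaps`; the `|B₁|β` member transfers pointwise in the index, the crossing terms at `Q₀ = 1` included).  Proof verbatim, one token.  Kind
«kernel-checked proof», theorems only, no `def`.

HONEST SCOPE.  Nothing of [4] Thm 3.3 is proved: the scalar flat β clause ([4] Thm 3.3 at `U = 1` for `G(1)` of (1.58) on the finite region WITH exterior data,
a-priori form, abelian, β reading) is the displayed HYPOTHESIS — not discharged.  A6-PARTIAL: the boundary pure-gauge mode `a = t·d𝟙_{□₀}` (flat-Landau, `J = 0`,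
`Φ₀ = 0`, `|B₁|β(a) = ηt`) makes the scalar β clause FALSE below an absolute threshold in `B₀` (line 1 needs `B₀ ≥ 1`, the gradient line a larger absolute
constant) — as in print, where `B₀` is [4] Thm 3.3's constant; the theorem holds for every `B₀ ≥ 0`, its hypothesis vacuous below the threshold (declared).
`B_∂ ≥ 0` is the tree's.  Count-neutral; N05 NOT discharged; one finite `𝕋⁴` programme at fixed `ε`, Bałaban as printed; nothing continuum ∕ ℝ⁴ ∕ OS ∕
mass-gap ∕ Clay.  No `sorry`, no `def`, no `instance`, no `notation`.  Unit `pub-ymgap-dag-n05-e` (g8), 2026-08-27.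
-/

noncomputable section

namespace Literature.MathematicalPhysics.QuantumFieldTheory.Balaban1983to89.B8Ineq159FlatOfScalarBdryBeta

open NormedSpace Finset
open Complex (I I_ne_zero)
open B7Prop1Explicit (e expUnit val_expUnit asum_seg_natCast boxVec seg)
open B7Eq78Linearization (conjR conjR_apply)
open B8Ineq132 (covDeriv covDerivFwd BondTouches)
open B8Eq143PlaqExpansion (pdiv)
open B8Eq146AExpansion (plaqCovDeriv plaqCovDeriv_eq_covDerivFwd iEta)
open B8Eq155JBound (Jcur wsup wsup_le le_wsup wsup_nonneg)
open B8ScaledSupNorm (weight msup Bdd bondNorm msup_le msup_nonneg weight_mul_norm_le_msup weight_neg_natCast weight_pos)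
open B8Eq138LandauZd (covDivB covLap QT IsLandau138 IsLandau138W logCfg isLandau138_congr)
open B8Eq184Proof (cfgExp)
open B8Eq140Level (SideTouches sideTouches_of_bondTouches)
open B7Prop4GeneralLevels (linCovIter)
open B7Prop3Flat (linQ)
open B7Prop4Flat (linQIter linQIter_zero linQIter_succ norm_linQIter_le)
open B9Eq316TowerFlatIsOneStep (linCovIter_one_left)
open B8Eq191FlatStencils (covDerivFwd_flat_apply covDeriv_flat_apply covLap_flat_apply QT_flat_apply)
open B7BlockAvgLog (mlog_exp)
open MatrixLog (mlog)

export B7Prop1Explicit (Site)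

variable {d : ℕ}
open B9SupplySockB9P3ZdBeta (CrossB)
open B8Ineq159FlatMaps (map_covDerivFwd_flat map_Jcur_flat isLandau138_map_flat map_linCovIter_flat logCfg_eq_of_cfgExp
  norm_covDerivFwd_flat_le norm_Jcur_flat_le)
/-! ## ★ Theorem 4's two-member (1.59) clause in EDITION β (averaging datum over `Λb ∪ {level-0 crossing bonds}`, exterior-collar allowance) at background `1`, from the scalar flat β clause -/

section Transfer

variable {𝔸 : Type*} [NormedRing 𝔸] [NormedAlgebra ℂ 𝔸] [CompleteSpace 𝔸] [NormOneClass 𝔸]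

/-- ★ **(1.59) AT THE FLAT BACKGROUND IN EDITION β, `⊗ id`: THEOREM 4's TWO-MEMBER (1.59) CLAUSE `H59Dβ₁` (averaging datum `|B₁|β` over the
constraint bonds AND the level-0 crossing bonds of `Ω₀`, exterior-collar allowance `+ B_∂Φ₀`) AT `U₀ = 1` FOR `𝔸`-VALUED EXPONENTS FOLLOWS FROM THE SCALAR
FLAT β CLAUSE.**  p526768's `flat159_clause_of_scalar_bdry` VERBATIM with the index token of `|B₁|` replaced by dag-n06-b's β index
(`p.2 ∈ Λb p.1 ∨ (p.1 = 0 ∧ CrossB (Ω 0) p.2)`, `B9SupplySockB9P3ZdBeta.SockB9P3D4β`): the transfer of the `|B₁|` member is pointwise in the index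
(`map_linCovIter_flat` at every level, `Q₀ = 1` included), so the proof is unchanged.  HYPOTHESIS `SCALAR` = the two β lines for every `ℂ`-valued flat-Landau
bond function on the collars; CONCLUSION = the two β lines for `A′` — exactly the `H59Dβ` shape of this seat's β chain at `U₀ = 1`.
[cite: Balaban1985RegularSpaces, (1.59) p.86, (1.58) p.86, (1.31) p.82, Thm 4 (1.68)–(1.69) p.88, (1.36)–(1.38) p.82, p.77; Balaban1985BackgroundPropagators, Thm 3.3 p.399, (3.47) p.398, (3.16) p.393, p.394 («⊗ identity»)] -/
theorem flat159_clause_of_scalar_bdryβ (hd2 : 2 ≤ d) {L : ℕ} (hL : 1 ≤ L) {η : ℝ} (hη : 0 < η) (m : ℕ)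
    (Ω : ℕ → Set (Site d)) (Λs : ℕ → Set (Site d)) (Λb : ℕ → Set (Site d × Fin d)) {B₀ Bbd c : ℝ} (hB₀ : 0 ≤ B₀) (hBbd : 0 ≤ Bbd)
    (hc0 : 0 ≤ c) (hc : c ≤ 1 / 2)
    (SCALAR : ∀ a : Site d → Fin d → ℂ,
      IsLandau138 L m η (Ω 0) Λs (1 : Site d → Fin d → ℂˣ) a →
      (∀ (y : Site d) (τ : Fin d), (∀ j, j ≤ m → ¬ SideTouches (Ω j) y τ) → a y τ = 0) →
      msup L m η (-(1 : ℝ)) (fun j (b : Site d × Fin d) => SideTouches (Ω j) b.1 b.2) (fun b => a b.1 b.2)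
          ≤ B₀ * (bondNorm L m η (-(3 : ℝ)) Ω (fun x μ => Jcur η (1 : Site d → Fin d → ℂˣ) a μ x)
            + wsup 1 (fun p : {p : ℕ × (Site d × Fin d) // p.1 ≤ m ∧ (p.2 ∈ Λb p.1 ∨ (p.1 = 0 ∧ CrossB (Ω 0) p.2))} =>
                linCovIter L (1 : Site d → Fin d → ℂˣ) (iEta η a) p.1.1 p.1.2.1 p.1.2.2)) + Bbd * msup L m η (-(1 : ℝ)) (fun j (b : Site d × Fin d) => j = 0 ∧ SideTouches (Ω 0) b.1 b.2 ∧ ¬ BondTouches (Ω 0) b.1 b.2)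
                (fun b => a b.1 b.2) ∧
        msup L m η (-(2 : ℝ)) (fun j (t : Fin d × Fin d × Site d) => SideTouches (Ω j) t.2.2 t.2.1)
            (fun t => covDerivFwd η (1 : Site d → Fin d → ℂˣ) t.1 (fun z => a z t.2.1) t.2.2)
          ≤ B₀ * (bondNorm L m η (-(3 : ℝ)) Ω (fun x μ => Jcur η (1 : Site d → Fin d → ℂˣ) a μ x)
            + wsup 1 (fun p : {p : ℕ × (Site d × Fin d) // p.1 ≤ m ∧ (p.2 ∈ Λb p.1 ∨ (p.1 = 0 ∧ CrossB (Ω 0) p.2))} =>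
                linCovIter L (1 : Site d → Fin d → ℂˣ) (iEta η a) p.1.1 p.1.2.1 p.1.2.2)) + Bbd * msup L m η (-(1 : ℝ)) (fun j (b : Site d × Fin d) => j = 0 ∧ SideTouches (Ω 0) b.1 b.2 ∧ ¬ BondTouches (Ω 0) b.1 b.2)
                (fun b => a b.1 b.2))
    (W : Site d → Fin d → 𝔸ˣ) (A' : Site d → Fin d → 𝔸)
    (hLan : IsLandau138W L m η (Ω 0) Λs (1 : Site d → Fin d → 𝔸ˣ) W)
    (hWA : ∀ j, j ≤ m → ∀ (y : Site d) (τ : Fin d), SideTouches (Ω j) y τ →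
      W y τ = cfgExp η A' y τ ∧ ‖A' y τ‖ ≤ c * ((L : ℝ) ^ j * η)⁻¹)
    (hA0 : ∀ (y : Site d) (τ : Fin d), (∀ j, j ≤ m → ¬ SideTouches (Ω j) y τ) → A' y τ = 0) :
    msup L m η (-(1 : ℝ)) (fun j (b : Site d × Fin d) => SideTouches (Ω j) b.1 b.2) (fun b => A' b.1 b.2)
        ≤ B₀ * (bondNorm L m η (-(3 : ℝ)) Ω (fun x μ => Jcur η (1 : Site d → Fin d → 𝔸ˣ) A' μ x)
          + wsup 1 (fun p : {p : ℕ × (Site d × Fin d) // p.1 ≤ m ∧ (p.2 ∈ Λb p.1 ∨ (p.1 = 0 ∧ CrossB (Ω 0) p.2))} =>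
              linCovIter L (1 : Site d → Fin d → 𝔸ˣ) (iEta η A') p.1.1 p.1.2.1 p.1.2.2)) + Bbd * msup L m η (-(1 : ℝ)) (fun j (b : Site d × Fin d) => j = 0 ∧ SideTouches (Ω 0) b.1 b.2 ∧ ¬ BondTouches (Ω 0) b.1 b.2)
              (fun b => A' b.1 b.2) ∧
      msup L m η (-(2 : ℝ)) (fun j (t : Fin d × Fin d × Site d) => SideTouches (Ω j) t.2.2 t.2.1)
          (fun t => covDerivFwd η (1 : Site d → Fin d → 𝔸ˣ) t.1 (fun z => A' z t.2.1) t.2.2)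
        ≤ B₀ * (bondNorm L m η (-(3 : ℝ)) Ω (fun x μ => Jcur η (1 : Site d → Fin d → 𝔸ˣ) A' μ x)
          + wsup 1 (fun p : {p : ℕ × (Site d × Fin d) // p.1 ≤ m ∧ (p.2 ∈ Λb p.1 ∨ (p.1 = 0 ∧ CrossB (Ω 0) p.2))} =>
              linCovIter L (1 : Site d → Fin d → 𝔸ˣ) (iEta η A') p.1.1 p.1.2.1 p.1.2.2)) + Bbd * msup L m η (-(1 : ℝ)) (fun j (b : Site d × Fin d) => j = 0 ∧ SideTouches (Ω 0) b.1 b.2 ∧ ¬ BondTouches (Ω 0) b.1 b.2)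
              (fun b => A' b.1 b.2) := by
  -- abbreviations for the two right-hand members of `A′`
  obtain ⟨XA, hXA⟩ : ∃ XA : ℝ, XA = bondNorm L m η (-(3 : ℝ)) Ω (fun x μ => Jcur η (1 : Site d → Fin d → 𝔸ˣ) A' μ x) := ⟨_, rfl⟩
  obtain ⟨YA, hYA⟩ : ∃ YA : ℝ, YA = wsup 1 (fun p : {p : ℕ × (Site d × Fin d) // p.1 ≤ m ∧ (p.2 ∈ Λb p.1 ∨ (p.1 = 0 ∧ CrossB (Ω 0) p.2))} =>
      linCovIter L (1 : Site d → Fin d → 𝔸ˣ) (iEta η A') p.1.1 p.1.2.1 p.1.2.2) := ⟨_, rfl⟩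
  obtain ⟨ZA, hZA⟩ : ∃ ZA : ℝ, ZA = msup L m η (-(1 : ℝ)) (fun j (b : Site d × Fin d) => j = 0 ∧ SideTouches (Ω 0) b.1 b.2 ∧ ¬ BondTouches (Ω 0) b.1 b.2)
      (fun b => A' b.1 b.2) := ⟨_, rfl⟩
  rw [← hXA, ← hYA, ← hZA]
  have hL0 : (0 : ℝ) < L := by exact_mod_cast hL
  have hL1 : (1 : ℝ) ≤ L := by exact_mod_cast hL
  have hLj : ∀ j : ℕ, (1 : ℝ) ≤ (L : ℝ) ^ j := fun j => one_le_pow₀ hL1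
  have hXA0 : 0 ≤ XA := by rw [hXA]; exact msup_nonneg L m hη.le _ _ _
  have hYA0 : 0 ≤ YA := by rw [hYA]; exact wsup_nonneg zero_le_one _
  have hZA0 : 0 ≤ ZA := by rw [hZA]; exact msup_nonneg L m hη.le _ _ _
  -- the full right-hand constant: the two (1.59) members + the exterior-collar allowance
  obtain ⟨K, hK⟩ : ∃ K : ℝ, K = B₀ * (XA + YA) + Bbd * ZA := ⟨_, rfl⟩
  have hK0 : 0 ≤ K := by rw [hK]; positivity
  -- two distinct directions (`d ≥ 2`): every bond is the side of a plaquette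
  have hex : ∀ τ : Fin d, ∃ κ : Fin d, κ ≠ τ := by
    intro τ
    by_cases h : τ = ⟨0, by omega⟩
    · refine ⟨⟨1, by omega⟩, fun h' => ?_⟩
      rw [h] at h'
      exact absurd (Fin.mk.inj_iff.mp h') (by norm_num)
    · exact ⟨⟨0, by omega⟩, fun h' => h h'.symm⟩
  -- Step 1: the uniform bound `‖A′‖ ≤ cη⁻¹`
  have hinvle : ∀ j : ℕ, ((L : ℝ) ^ j * η)⁻¹ ≤ η⁻¹ := fun j =>
    inv_anti₀ hη (le_mul_of_one_le_left hη.le (hLj j))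
  have hbd : ∀ (y : Site d) (τ : Fin d), ‖A' y τ‖ ≤ c * η⁻¹ := by
    intro y τ
    by_cases h : ∃ j, j ≤ m ∧ SideTouches (Ω j) y τ
    · obtain ⟨j, hj, hs⟩ := h
      exact ((hWA j hj y τ hs).2).trans (mul_le_mul_of_nonneg_left (hinvle j) hc0)
    · simp only [not_exists, not_and] at h
      rw [hA0 y τ fun j hj hs => h j hj hs, norm_zero]
      positivity
  -- Step 2: on the bonds touching `Ω 0` the exponent of record is `A′`, so `A′` is in the flat Landau gauge
  have hlog : ∀ (x : Site d) (μ : Fin d), BondTouches (Ω 0) x μ → logCfg η W x μ = A' x μ := by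
    intro x μ hb
    obtain ⟨κ, hκ⟩ := hex μ
    obtain ⟨hW, hsm⟩ := hWA 0 (Nat.zero_le _) x μ (sideTouches_of_bondTouches hκ hb)
    refine logCfg_eq_of_cfgExp hη hW ?_
    rw [pow_zero, one_mul] at hsm
    calc η * ‖A' x μ‖ ≤ η * (c * η⁻¹) := mul_le_mul_of_nonneg_left hsm hη.le
      _ = c := by field_simp
      _ ≤ 1 / 2 := hc
  have hLanA : IsLandau138 L m η (Ω 0) Λs (1 : Site d → Fin d → 𝔸ˣ) A' :=
    (isLandau138_congr η L (1 : Site d → Fin d → 𝔸ˣ) hlog).mp hLan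
  -- Step 3: the `Bdd` side conditions of `A′`'s right-hand families
  have hw3 : ∀ j : ℕ, weight L η (-(3 : ℝ)) j = ((L : ℝ) ^ j * η) ^ 3 := fun j => by
    simpa using weight_neg_natCast L η 3 j
  have hw2 : ∀ j : ℕ, weight L η (-(2 : ℝ)) j = ((L : ℝ) ^ j * η) ^ 2 := fun j => by
    simpa using weight_neg_natCast L η 2 j
  have hw1 : ∀ j : ℕ, weight L η (-(1 : ℝ)) j = (L : ℝ) ^ j * η := fun j => by
    simpa using weight_neg_natCast L η 1 j
  have hscale : ∀ j, j ≤ m → (L : ℝ) ^ j * η ≤ (L : ℝ) ^ m * η := fun j hj =>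
    mul_le_mul_of_nonneg_right (pow_le_pow_right₀ hL1 hj) hη.le
  have hscale0 : ∀ j : ℕ, 0 ≤ (L : ℝ) ^ j * η := fun j => by positivity
  obtain ⟨J₀, hJ₀⟩ : ∃ J₀ : ℝ, J₀ =
      (d : ℝ) * (η⁻¹ * ((η⁻¹ * (c * η⁻¹ + c * η⁻¹) + η⁻¹ * (c * η⁻¹ + c * η⁻¹)) +
        (η⁻¹ * (c * η⁻¹ + c * η⁻¹) + η⁻¹ * (c * η⁻¹ + c * η⁻¹)))) +
      (d : ℝ) * (η⁻¹ * ((η⁻¹ * (c * η⁻¹ + c * η⁻¹) + η⁻¹ * (c * η⁻¹ + c * η⁻¹)) +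
        (η⁻¹ * (c * η⁻¹ + c * η⁻¹) + η⁻¹ * (c * η⁻¹ + c * η⁻¹)))) := ⟨_, rfl⟩
  have hJ₀0 : 0 ≤ J₀ := by rw [hJ₀]; positivity
  have hJbd : ∀ (μ : Fin d) (x : Site d), ‖Jcur η (1 : Site d → Fin d → 𝔸ˣ) A' μ x‖ ≤ J₀ := fun μ x => by
    rw [hJ₀]; exact norm_Jcur_flat_le hη (by positivity) hbd μ x
  have hBddJ : Bdd L m η (-(3 : ℝ)) (fun j (b : Site d × Fin d) => BondTouches (Ω j) b.1 b.2)
      (fun b => Jcur η (1 : Site d → Fin d → 𝔸ˣ) A' b.2 b.1) := by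
    refine ⟨((L : ℝ) ^ m * η) ^ 3 * J₀, fun j hj b _ => ?_⟩
    rw [hw3]
    exact mul_le_mul (pow_le_pow_left₀ (hscale0 j) (hscale j hj) 3) (hJbd _ _) (norm_nonneg _) (by positivity)
  have hiEta : ∀ (y : Site d) (κ : Fin d), ‖iEta η A' y κ‖ ≤ c := fun y κ =>
    (B8Eq146AExpansion.norm_iEta_le hη.le hbd y κ).trans (le_of_eq (by field_simp))
  have hQbd : ∀ p : {p : ℕ × (Site d × Fin d) // p.1 ≤ m ∧ (p.2 ∈ Λb p.1 ∨ (p.1 = 0 ∧ CrossB (Ω 0) p.2))},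
      1 * ‖linCovIter L (1 : Site d → Fin d → 𝔸ˣ) (iEta η A') p.1.1 p.1.2.1 p.1.2.2‖ ≤ (L : ℝ) ^ m * c := by
    intro p
    rw [one_mul, linCovIter_one_left L hL _ hc0 hiEta p.1.1]
    exact (norm_linQIter_le L hL _ hc0 hiEta p.1.1 p.1.2.1 p.1.2.2).trans
      (mul_le_mul_of_nonneg_right (pow_le_pow_right₀ hL1 p.2.1) hc0)
  -- Step 4: for every functional `f`, the scalar clause at `a_f = f ∘ A′` bounds `f`'s view of both members by `‖f‖·B₀(XA + YA)`
  have hf : ∀ f : StrongDual ℂ 𝔸,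
      msup L m η (-(1 : ℝ)) (fun j (b : Site d × Fin d) => SideTouches (Ω j) b.1 b.2) (fun b => f (A' b.1 b.2))
          ≤ ‖f‖ * K ∧
        msup L m η (-(2 : ℝ)) (fun j (t : Fin d × Fin d × Site d) => SideTouches (Ω j) t.2.2 t.2.1)
            (fun t => covDerivFwd η (1 : Site d → Fin d → ℂˣ) t.1 (fun z => f (A' z t.2.1)) t.2.2)
          ≤ ‖f‖ * K := by
    intro f
    obtain ⟨h1, h2⟩ := SCALAR (fun y τ => f (A' y τ)) (isLandau138_map_flat f hLanA)
      (fun y τ h => by simp only [hA0 y τ h, map_zero])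
    -- the two right-hand members of `a_f` against those of `A′`
    have hX : bondNorm L m η (-(3 : ℝ)) Ω (fun x μ => Jcur η (1 : Site d → Fin d → ℂˣ) (fun y τ => f (A' y τ)) μ x)
        ≤ ‖f‖ * XA := by
      refine msup_le (by positivity) fun j hj b hb => ?_
      have hJ : Jcur η (1 : Site d → Fin d → ℂˣ) (fun y τ => f (A' y τ)) b.2 b.1 =
          f (Jcur η (1 : Site d → Fin d → 𝔸ˣ) A' b.2 b.1) := (map_Jcur_flat f η A' b.2 b.1).symm
      have hw0 : 0 ≤ weight L η (-(3 : ℝ)) j := B8ScaledSupNorm.weight_nonneg L hη.le _ j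
      calc weight L η (-(3 : ℝ)) j * ‖Jcur η (1 : Site d → Fin d → ℂˣ) (fun y τ => f (A' y τ)) b.2 b.1‖
          ≤ weight L η (-(3 : ℝ)) j * (‖f‖ * ‖Jcur η (1 : Site d → Fin d → 𝔸ˣ) A' b.2 b.1‖) := by
            rw [hJ]; exact mul_le_mul_of_nonneg_left (f.le_opNorm _) hw0
        _ = ‖f‖ * (weight L η (-(3 : ℝ)) j * ‖Jcur η (1 : Site d → Fin d → 𝔸ˣ) A' b.2 b.1‖) := by ring
        _ ≤ ‖f‖ * XA := by
            rw [hXA]; exact mul_le_mul_of_nonneg_left (weight_mul_norm_le_msup hBddJ hj hb) (norm_nonneg _)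
    have hY : wsup 1 (fun p : {p : ℕ × (Site d × Fin d) // p.1 ≤ m ∧ (p.2 ∈ Λb p.1 ∨ (p.1 = 0 ∧ CrossB (Ω 0) p.2))} =>
        linCovIter L (1 : Site d → Fin d → ℂˣ) (iEta η (fun y τ => f (A' y τ))) p.1.1 p.1.2.1 p.1.2.2) ≤ ‖f‖ * YA := by
      refine wsup_le (fun p => ?_) (by positivity)
      have hfun : (fun w ν => f (iEta η A' w ν)) = iEta η (fun y τ => f (A' y τ)) := by
        funext w ν
        simp only [iEta, map_smul, smul_eq_mul]
      have hQ : linCovIter L (1 : Site d → Fin d → ℂˣ) (iEta η (fun y τ => f (A' y τ))) p.1.1 p.1.2.1 p.1.2.2 =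
          f (linCovIter L (1 : Site d → Fin d → 𝔸ˣ) (iEta η A') p.1.1 p.1.2.1 p.1.2.2) := by
        rw [← hfun]; exact (map_linCovIter_flat f hL (iEta η A') hc0 hiEta _ _ _).symm
      calc 1 * ‖linCovIter L (1 : Site d → Fin d → ℂˣ) (iEta η (fun y τ => f (A' y τ))) p.1.1 p.1.2.1 p.1.2.2‖
          ≤ ‖f‖ * (1 * ‖linCovIter L (1 : Site d → Fin d → 𝔸ˣ) (iEta η A') p.1.1 p.1.2.1 p.1.2.2‖) := by
            rw [hQ, one_mul, one_mul]; exact f.le_opNorm _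
        _ ≤ ‖f‖ * YA := by rw [hYA]; exact mul_le_mul_of_nonneg_left (le_wsup hQbd p) (norm_nonneg _)
    -- the exterior-collar member of `a_f` against that of `A′`
    have hZ : msup L m η (-(1 : ℝ)) (fun j (b : Site d × Fin d) => j = 0 ∧ SideTouches (Ω 0) b.1 b.2 ∧ ¬ BondTouches (Ω 0) b.1 b.2)
        (fun b => f (A' b.1 b.2)) ≤ ‖f‖ * ZA := by
      refine msup_le (by positivity) fun j hj b hb => ?_
      have hw0 : 0 ≤ weight L η (-(1 : ℝ)) j := B8ScaledSupNorm.weight_nonneg L hη.le _ j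
      have hBddZ : Bdd L m η (-(1 : ℝ)) (fun j (b : Site d × Fin d) => j = 0 ∧ SideTouches (Ω 0) b.1 b.2 ∧ ¬ BondTouches (Ω 0) b.1 b.2)
          (fun b => A' b.1 b.2) := by
        refine ⟨(L : ℝ) ^ m * η * (c * η⁻¹), fun j' hj' b' _ => ?_⟩
        rw [hw1]
        exact mul_le_mul (hscale j' hj') (hbd b'.1 b'.2) (norm_nonneg _) (hscale0 m)
      calc weight L η (-(1 : ℝ)) j * ‖f (A' b.1 b.2)‖
          ≤ weight L η (-(1 : ℝ)) j * (‖f‖ * ‖A' b.1 b.2‖) := mul_le_mul_of_nonneg_left (f.le_opNorm _) hw0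
        _ = ‖f‖ * (weight L η (-(1 : ℝ)) j * ‖A' b.1 b.2‖) := by ring
        _ ≤ ‖f‖ * ZA := by
            rw [hZA]; exact mul_le_mul_of_nonneg_left (weight_mul_norm_le_msup hBddZ hj hb) (norm_nonneg _)
    have hR : B₀ * (bondNorm L m η (-(3 : ℝ)) Ω (fun x μ => Jcur η (1 : Site d → Fin d → ℂˣ) (fun y τ => f (A' y τ)) μ x)
        + wsup 1 (fun p : {p : ℕ × (Site d × Fin d) // p.1 ≤ m ∧ (p.2 ∈ Λb p.1 ∨ (p.1 = 0 ∧ CrossB (Ω 0) p.2))} =>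
            linCovIter L (1 : Site d → Fin d → ℂˣ) (iEta η (fun y τ => f (A' y τ))) p.1.1 p.1.2.1 p.1.2.2))
        + Bbd * msup L m η (-(1 : ℝ)) (fun j (b : Site d × Fin d) => j = 0 ∧ SideTouches (Ω 0) b.1 b.2 ∧ ¬ BondTouches (Ω 0) b.1 b.2)
            (fun b => f (A' b.1 b.2))
        ≤ ‖f‖ * K := by
      calc B₀ * (bondNorm L m η (-(3 : ℝ)) Ω (fun x μ => Jcur η (1 : Site d → Fin d → ℂˣ) (fun y τ => f (A' y τ)) μ x)
            + wsup 1 (fun p : {p : ℕ × (Site d × Fin d) // p.1 ≤ m ∧ (p.2 ∈ Λb p.1 ∨ (p.1 = 0 ∧ CrossB (Ω 0) p.2))} =>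
              linCovIter L (1 : Site d → Fin d → ℂˣ) (iEta η (fun y τ => f (A' y τ))) p.1.1 p.1.2.1 p.1.2.2))
            + Bbd * msup L m η (-(1 : ℝ)) (fun j (b : Site d × Fin d) => j = 0 ∧ SideTouches (Ω 0) b.1 b.2 ∧ ¬ BondTouches (Ω 0) b.1 b.2)
              (fun b => f (A' b.1 b.2))
          ≤ B₀ * (‖f‖ * XA + ‖f‖ * YA) + Bbd * (‖f‖ * ZA) :=
            add_le_add (mul_le_mul_of_nonneg_left (add_le_add hX hY) hB₀) (mul_le_mul_of_nonneg_left hZ hBbd)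
        _ = ‖f‖ * K := by rw [hK]; ring
    exact ⟨h1.trans hR, h2.trans hR⟩
  -- Step 5: Hahn–Banach, member by member
  rw [← hK]
  refine ⟨msup_le hK0 fun j hj b hb => ?_, msup_le hK0 fun j hj t ht => ?_⟩
  · -- `|A′|₍₋₁₎`
    have hwpos : 0 < weight L η (-(1 : ℝ)) j := weight_pos hL hη _ j
    have key : ∀ f : StrongDual ℂ 𝔸, weight L η (-(1 : ℝ)) j * ‖f (A' b.1 b.2)‖ ≤ ‖f‖ * K := by
      intro f
      have hBdd : Bdd L m η (-(1 : ℝ)) (fun j (b : Site d × Fin d) => SideTouches (Ω j) b.1 b.2)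
          (fun b => f (A' b.1 b.2)) := by
        refine ⟨‖f‖ * c, fun j' hj' b' hb' => ?_⟩
        rw [hw1]
        calc (L : ℝ) ^ j' * η * ‖f (A' b'.1 b'.2)‖ ≤ (L : ℝ) ^ j' * η * (‖f‖ * (c * ((L : ℝ) ^ j' * η)⁻¹)) :=
              mul_le_mul_of_nonneg_left ((f.le_opNorm _).trans
                (mul_le_mul_of_nonneg_left (hWA j' hj' b'.1 b'.2 hb').2 (norm_nonneg _))) (hscale0 j')
          _ = ‖f‖ * c := by field_simp
      exact (weight_mul_norm_le_msup hBdd hj hb).trans (hf f).1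
    have hdual : ‖A' b.1 b.2‖ ≤ K * (weight L η (-(1 : ℝ)) j)⁻¹ := by
      refine NormedSpace.norm_le_dual_bound ℂ _ (by positivity) fun f => ?_
      have h1 : ‖f (A' b.1 b.2)‖ ≤ ‖f‖ * K / weight L η (-(1 : ℝ)) j := by
        rw [le_div_iff₀ hwpos, mul_comm]; exact key f
      calc ‖f (A' b.1 b.2)‖ ≤ ‖f‖ * K / weight L η (-(1 : ℝ)) j := h1
        _ = K * (weight L η (-(1 : ℝ)) j)⁻¹ * ‖f‖ := by ring
    calc weight L η (-(1 : ℝ)) j * ‖A' b.1 b.2‖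
        ≤ weight L η (-(1 : ℝ)) j * (K * (weight L η (-(1 : ℝ)) j)⁻¹) :=
          mul_le_mul_of_nonneg_left hdual hwpos.le
      _ = K := by field_simp
  · -- `|∇^η_1 A′|₍₋₂₎`
    have hwpos : 0 < weight L η (-(2 : ℝ)) j := weight_pos hL hη _ j
    have key : ∀ f : StrongDual ℂ 𝔸, weight L η (-(2 : ℝ)) j *
        ‖f (covDerivFwd η (1 : Site d → Fin d → 𝔸ˣ) t.1 (fun z => A' z t.2.1) t.2.2)‖ ≤ ‖f‖ * K := by
      intro f
      have hBdd : Bdd L m η (-(2 : ℝ)) (fun j (t : Fin d × Fin d × Site d) => SideTouches (Ω j) t.2.2 t.2.1)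
          (fun t => covDerivFwd η (1 : Site d → Fin d → ℂˣ) t.1 (fun z => f (A' z t.2.1)) t.2.2) := by
        refine ⟨((L : ℝ) ^ m * η) ^ 2 * (η⁻¹ * (‖f‖ * (c * η⁻¹) + ‖f‖ * (c * η⁻¹))), fun j' hj' t' _ => ?_⟩
        rw [hw2]
        have hfb : ∀ z, ‖f (A' z t'.2.1)‖ ≤ ‖f‖ * (c * η⁻¹) := fun z =>
          (f.le_opNorm _).trans (mul_le_mul_of_nonneg_left (hbd z _) (norm_nonneg _))
        exact mul_le_mul (pow_le_pow_left₀ (hscale0 j') (hscale j' hj') 2) (norm_covDerivFwd_flat_le hη hfb _ _)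
          (norm_nonneg _) (by positivity)
      have hD : covDerivFwd η (1 : Site d → Fin d → ℂˣ) t.1 (fun z => f (A' z t.2.1)) t.2.2 =
          f (covDerivFwd η (1 : Site d → Fin d → 𝔸ˣ) t.1 (fun z => A' z t.2.1) t.2.2) :=
        (map_covDerivFwd_flat f η t.1 (fun z => A' z t.2.1) t.2.2).symm
      have h := weight_mul_norm_le_msup hBdd hj ht
      rw [hD] at h
      exact h.trans (hf f).2
    have hdual : ‖covDerivFwd η (1 : Site d → Fin d → 𝔸ˣ) t.1 (fun z => A' z t.2.1) t.2.2‖ ≤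
        K * (weight L η (-(2 : ℝ)) j)⁻¹ := by
      refine NormedSpace.norm_le_dual_bound ℂ _ (by positivity) fun f => ?_
      have h1 : ‖f (covDerivFwd η (1 : Site d → Fin d → 𝔸ˣ) t.1 (fun z => A' z t.2.1) t.2.2)‖ ≤
          ‖f‖ * K / weight L η (-(2 : ℝ)) j := by
        rw [le_div_iff₀ hwpos, mul_comm]; exact key f
      calc ‖f (covDerivFwd η (1 : Site d → Fin d → 𝔸ˣ) t.1 (fun z => A' z t.2.1) t.2.2)‖
          ≤ ‖f‖ * K / weight L η (-(2 : ℝ)) j := h1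
        _ = K * (weight L η (-(2 : ℝ)) j)⁻¹ * ‖f‖ := by ring
    calc weight L η (-(2 : ℝ)) j * ‖covDerivFwd η (1 : Site d → Fin d → 𝔸ˣ) t.1 (fun z => A' z t.2.1) t.2.2‖
        ≤ weight L η (-(2 : ℝ)) j * (K * (weight L η (-(2 : ℝ)) j)⁻¹) :=
          mul_le_mul_of_nonneg_left hdual hwpos.le
      _ = K := by field_simp

#print axioms flat159_clause_of_scalar_bdryβ

end Transfer

end Literature.MathematicalPhysics.QuantumFieldTheory.Balaban1983to89.B8Ineq159FlatOfScalarBdryBeta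

end

/-! ## HONEST SCOPE — VACUOUS AT NESTED MEMBERS AS TYPED (2026-08-27, seat `pub-ymgap-dag-n05-e` g9; director-ym LINE №196, dag-lead DEDUP-349∕350)

This file is MEMBER-GENERIC: its theorems take a (1.59)-type clause or socket in EDITION β (SCALAR SC2-shape, or the 𝔸-valued `SockB9P3D4β` ∕ `H59Dβ` ∕
four-line bodies) over a datum class `Λb` obeying the law «fine box ⊂ Ω_j» (`hbox`, `ZdIdx.hbox`, `cubeLamB` condition 1).  At every NESTED member with
genuine shells — in particular every cube member of (1.131) with `k ≥ 1` — that law EMPTIES print's crossing bonds of (1.31) at levels `j ≥ 1` and the interior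
SHELL GAUGE MODES `∂(𝟙λ)` defeat the clause for ALL constants: there the hypothesis is UNINHABITED and the theorems are VACUOUS AS TYPED — KERNEL CERTIFICATE
dag-n05-c `B8Ineq159FlatShellModeVacuity` (p572834; ref-E g12 READ-11 A6-FINAL) and `…ShellModeVacuityUniv` (p576185, the lawful `Ω₀ = ℤᵈ` towered member).
No claim is made here about tower-free members.  The theorems stay TRUE and PASS-AS-DECLARED.  Nothing of [Balaban1985RegularSpaces] is refuted: print's class
([B6] (2.3)) contains the crossing bonds and kills the modes (dag-n05-c `B8Ineq159FlatShellModeCrossingDatum`).  SUPERSEDED BY EDITION γ: class dag-n05-c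
`cubeLamBP`, socket dag-n06-b `B9SupplySockB9P3ZdGamma`, driver this seat's `B8Eq142KLevelLocalGamma` ∕ `B8Thm4KLevelGamma` (law «box ⊂ Ω_{j−1}»); this file is
kept as history and for its class-independent mechanics, re-run by token swap in γ.  Count-neutral; N05 NOT discharged; nothing continuum ∕ ℝ⁴ ∕ OS ∕
mass-gap ∕ Clay. -/
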